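import Summits.CriticalPhenomena.CardyFormulaZ2.Theorems.CardyComplexConeParafermionToSLESixFamiliesDiamondTraceTurn
import Summits.CriticalPhenomena.CardyFormulaZ2.Theorems.CardyComplexConeParafermionToSLESixFamiliesDiamondIdentifySideCells
import Summits.CriticalPhenomena.CardyFormulaZ2.Theorems.CardyComplexConeParafermionToSLESixFamiliesDiamondTraceLayers
import HarnessLib

/-!
# The frame of a boundary segment of a marked diamond: side index, outward frame, layer formula, and the bulk of
# the segment eventually in the mesh (line `potential-darboux-picard-diamond`, S1″)

Crux `ParafermionToSLESixFamilies` (stmt-CriticalPhenomena-11389), line `potential-darboux-picard-diamond`, stub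
`stub_exactPotentialTracePh2` (S1″). Companion of `…DiamondTraceLayers.lean` (not imported here; the two files meet in
their users): that file reads the carrier, the discrete boundary and the inner faces near a straight side off the
integer LAYER FUNCTION `layerFn j`, given a frame `e′` of the side in which the tilted abscissa of mesh points is
`(δ/√2)·layerFn j + X₀` and the site sits in the bulk of the side. This file PRODUCES those data for an oriented
boundary segment `[p, q]` of a marked diamond (`IsBdrySegment`, frame `dRot c`, half-widths `α, β`):

* `sideFrame k = i, 1, −i, −1`, `sideHalfWidth`, `sideHalfLength` — the outward frame unit of side `k` of the frame
  rectangle (sides `0,1,2,3` counter-clockwise from the cut corner `(−α, −β)`, `dParam`) and the half-widths across /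
  along it; `carrier_sideFrame` — the carrier rewritten in the frame `exp(-iπ/4) · sideFrame k`;
  `re_dParam_mul_sideFrame`, `im_dParam_mul_sideFrame` — side `k` is the line `re = sideHalfWidth`, parametrised by `im`;
* `exists_re_tilt_sideFrame_eq_layerFn` — in that frame the tilted abscissa of `δx` is `(δ/√2)·layerFn (k + 2) x + X₀`:
  **the touch darts of side `k` have orientation `j = k + 2`**;
* `meshPoint_chainStep` — the chain step `x ↦ x − u_j − u_{j+1}` moves the mesh point by `√2 δ` times the
  counter-clockwise unit direction `dDir k · e^{iπ/4}` of the side (the direction of `q − p`, `sub_eq_of_segData`);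
* `eventually_sideBulk` (registered, `--supports` the crux) — along an admissible family: the side data `k, s, t` of
  `[p, q]` (`isBdrySegment_sideData`) and, for all small `δ`, the mesh facts (`δ > 0`, every lattice point of the
  diamond in `Ω_δ`), the layer formula with its last inside layer `n`, and for every lattice site within `6δ` of
  `[p, q]` at distance `≥ η` from `p, q` the two bulk inequalities of `…DiamondTraceLayers.lean`.

Elementary frame bookkeeping; nothing cited.
-/

noncomputable section

namespace Summit.CriticalPhenomena.CardyFormulaZ2.Cruxes.ParafermionToSLESixFamilies.PotentialDarbouxPicardDiamond

open scoped Topology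
open Filter Set Metric Complex
open Literature.Probability Literature.Probability.LatticeModels Literature.Probability.Percolation
open Literature.Probability.LatticeModels.DiscreteDobrushin
open Literature.Probability.RandomPlanarGeometry
open Summit.CriticalPhenomena.CardyFormulaZ2.Cruxes.ParafermionToSLESixFamilies.IicTraceFluxPairing (IsFamily)

/-! ## The outward frame of a side -/

/-- The outward frame unit of side `k` of the frame rectangle: `i · conj (dDir k)`, i.e. `i, 1, −i, −1`. -/
def sideFrame (k : Fin 4) : ℂ := ![I, 1, -I, -1] k

/-- The half-width of the rectangle ACROSS side `k`: `β, α, β, α`. -/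
def sideHalfWidth (α β : ℝ) (k : Fin 4) : ℝ := ![β, α, β, α] k

/-- The half-length of side `k`: `α, β, α, β`. -/
def sideHalfLength (α β : ℝ) (k : Fin 4) : ℝ := ![α, β, α, β] k

/-- The frame units are unimodular. -/
theorem norm_sideFrame (k : Fin 4) : ‖sideFrame k‖ = 1 := by
  fin_cases k <;> simp [sideFrame]

/-- Twice the half-length is the length of the side. -/
theorem two_mul_sideHalfLength (α β : ℝ) (k : Fin 4) : 2 * sideHalfLength α β k = dLen α β k := by
  fin_cases k <;> simp [sideHalfLength, dLen]

/-- The half-widths are at least `min α β`. -/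
theorem min_le_sideHalfWidth (α β : ℝ) (k : Fin 4) : min α β ≤ sideHalfWidth α β k := by
  fin_cases k <;> simp [sideHalfWidth]

/-- **The carrier in the frame of side `k`**: the open tilted rectangle of the frame `e` is the open tilted rectangle
of the frame `e · sideFrame k` with half-widths `sideHalfWidth` (across) and `sideHalfLength` (along). -/
theorem carrier_sideFrame (c e : ℂ) (α β : ℝ) (k : Fin 4) :
    {z : ℂ | |((z - c) * e).re| < α ∧ |((z - c) * e).im| < β} =
      {z : ℂ | |((z - c) * (e * sideFrame k)).re| < sideHalfWidth α β k ∧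
        |((z - c) * (e * sideFrame k)).im| < sideHalfLength α β k} := by
  ext z
  fin_cases k <;>
    simp only [sideFrame, sideHalfWidth, sideHalfLength, mem_setOf_eq, Matrix.cons_val, ← mul_assoc, mul_I_re,
      mul_I_im, mul_one, mul_neg, neg_re, neg_im, abs_neg, neg_neg, Fin.zero_eta, Fin.mk_one, Fin.reduceFinMk,
      Matrix.cons_val_zero, Matrix.cons_val_one] <;> tauto

/-- **Side `k` is the line `re = sideHalfWidth` of its frame.** -/
theorem re_dParam_mul_sideFrame (α β : ℝ) (k : Fin 4) (σ : ℝ) :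
    (dParam α β k σ * sideFrame k).re = sideHalfWidth α β k := by
  fin_cases k <;> simp [dParam, dCorner, dDir, sideFrame, sideHalfWidth]

/-- Along side `k` the frame ordinate is the arc length minus the half-length. -/
theorem im_dParam_mul_sideFrame (α β : ℝ) (k : Fin 4) (σ : ℝ) :
    (dParam α β k σ * sideFrame k).im = -sideHalfLength α β k + σ := by
  fin_cases k <;> simp [dParam, dCorner, dDir, sideFrame, sideHalfLength] <;> ring

/-! ## The layer formula and the chain step of a side -/

/-- **The orientation of side `k` is `k + 2`**: in the frame `exp(-iπ/4) · sideFrame k` the tilted abscissa of the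
mesh point `δx` is `(δ/√2) · layerFn (k + 2) x + X₀` for a constant `X₀`. -/
theorem exists_re_tilt_sideFrame_eq_layerFn (δ : ℝ) (c : ℂ) (k : Fin 4) : ∃ X₀ : ℝ, ∀ x : Site 2,
    ((meshPoint δ x - c) * (exp (-(Real.pi / 4 : ℝ) * I) * sideFrame k)).re =
      Real.sqrt 2 / 2 * δ * layerFn (k + 2) x + X₀ := by
  obtain ⟨h3, h1, h0, h2⟩ := re_tilt_meshPoint_eq_layerFn δ c
  fin_cases k
  · exact ⟨Real.sqrt 2 / 2 * (c.im - c.re), fun x => by simpa [sideFrame] using h2 x⟩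
  · exact ⟨-(Real.sqrt 2 / 2 * (c.re + c.im)), fun x => by simpa [sideFrame] using h3 x⟩
  · exact ⟨-(Real.sqrt 2 / 2 * (c.im - c.re)), fun x => by simpa [sideFrame] using h0 x⟩
  · refine ⟨Real.sqrt 2 / 2 * (c.re + c.im), fun x => ?_⟩
    have := h1 x
    simp only [mul_neg] at this
    simpa [sideFrame] using this

/-- The lattice chain step of orientation `j = k + 2`, `−u_j − u_{j+1}`, as a complex number: `√2 · dDir k · e^{iπ/4}`
(the counter-clockwise unit direction of side `k` in the original plane, times `√2`). -/
theorem meshPoint_chainStep (δ : ℝ) (k : Fin 4) (x : Site 2) :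
    meshPoint δ (x - cornerUnit (k + 2) - cornerUnit (k + 2 + 1)) - meshPoint δ x =
      ((Real.sqrt 2 * δ : ℝ) : ℂ) * (dDir k * exp ((Real.pi / 4 : ℝ) * I)) := by
  have hexp : exp ((Real.pi / 4 : ℝ) * I) = ((Real.sqrt 2 / 2 : ℝ) : ℂ) * (1 + I) := by
    rw [show ((Real.pi / 4 : ℝ) : ℂ) * I = (Real.pi / 4 : ℝ) * I by norm_cast, ← Complex.cos_add_sin_I,
      show ((Real.pi / 4 : ℝ) : ℂ) = (Real.pi / 4 : ℝ) by norm_cast, ← Complex.ofReal_cos, ← Complex.ofReal_sin,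
      Real.cos_pi_div_four, Real.sin_pi_div_four]
    push_cast; ring
  have hs : (Real.sqrt 2 : ℂ) * (Real.sqrt 2 : ℂ) = 2 := by
    rw [← Complex.ofReal_mul, Real.mul_self_sqrt (by norm_num : (0:ℝ) ≤ 2)]; norm_num
  have key : ((Real.sqrt 2 * δ : ℝ) : ℂ) * (dDir k * exp ((Real.pi / 4 : ℝ) * I)) = (δ : ℂ) * (dDir k * (1 + I)) := by
    rw [hexp]; push_cast
    linear_combination (δ : ℂ) * dDir k * (1 + I) / 2 * hs
  rw [key]
  apply Complex.ext
  · fin_cases k <;> simp [meshPoint_re, cornerUnit, dDir] <;> ring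
  · fin_cases k <;> simp [meshPoint_im, cornerUnit, dDir] <;> ring

/-- `q − p` from the side data: `q − p = (t − s) · dDir k · e^{iπ/4}`, of norm `t − s`. -/
theorem sub_eq_of_segData (c : ℂ) {α β : ℝ} {k : Fin 4} {s t : ℝ} {p q : ℂ} (hP : dRot c p = dParam α β k s)
    (hQ : dRot c q = dParam α β k t) :
    q - p = ((t - s : ℝ) : ℂ) * (dDir k * exp ((Real.pi / 4 : ℝ) * I)) ∧ (s ≤ t → ‖q - p‖ = t - s) := by
  have hd : dRot c q - dRot c p = ((t - s : ℝ) : ℂ) * dDir k := by rw [hP, hQ, dParam_sub]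
  rw [dRot_sub] at hd
  have hqp : q - p = ((t - s : ℝ) : ℂ) * (dDir k * exp ((Real.pi / 4 : ℝ) * I)) := by
    have := congrArg (· * exp ((Real.pi / 4 : ℝ) * I)) hd
    simp only [mul_assoc, exp_neg_quarter_mul_exp_quarter, mul_one] at this
    rw [this]
  refine ⟨hqp, fun hst => ?_⟩
  have hdn : ‖dDir k‖ = 1 := by fin_cases k <;> simp [dDir]
  have hen : ‖exp ((Real.pi / 4 : ℝ) * I)‖ = 1 := norm_exp_ofReal_mul_I _
  rw [hqp, norm_mul, norm_mul, hdn, hen, mul_one, mul_one, norm_real, Real.norm_eq_abs, abs_of_nonneg (by linarith)]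

/-! ## The bulk of a segment, eventually in the mesh -/

/-- The last layer inside: for `h > 0` there is an integer `n` with `h n + X₀ < a ≤ h (n + 1) + X₀`. -/
theorem exists_lastLayer {h X₀ a : ℝ} (hh : 0 < h) : ∃ n : ℤ, h * n + X₀ < a ∧ a ≤ h * (n + 1) + X₀ := by
  refine ⟨⌈(a - X₀) / h⌉ - 1, ?_, ?_⟩
  · have h1 : ((⌈(a - X₀) / h⌉ - 1 : ℤ) : ℝ) < (a - X₀) / h := by
      push_cast; linarith [Int.ceil_lt_add_one ((a - X₀) / h)]
    have := (lt_div_iff₀ hh).1 h1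
    linarith
  · have h1 : (a - X₀) / h ≤ ((⌈(a - X₀) / h⌉ - 1 : ℤ) : ℝ) + 1 := by
      push_cast; linarith [Int.le_ceil ((a - X₀) / h)]
    have := (div_le_iff₀ hh).1 h1
    linarith

/-- **Frame coordinates of the points of `[p, q]`**: abscissa `sideHalfWidth`, ordinate at least `η′` away from
`± sideHalfLength` if the point is `η′`-away from `p` and `q`. -/
theorem tilt_of_mem_segment (c : ℂ) {α β : ℝ} {k : Fin 4} {s t : ℝ} (hs : 0 ≤ s) (hst : s < t)
    (ht : t ≤ dLen α β k) {p q : ℂ} (hP : dRot c p = dParam α β k s) (hQ : dRot c q = dParam α β k t) {z : ℂ}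
    (hz : z ∈ segment ℝ p q) {η' : ℝ} (hzp : η' ≤ dist z p) (hzq : η' ≤ dist z q) :
    ((z - c) * (exp (-(Real.pi / 4 : ℝ) * I) * sideFrame k)).re = sideHalfWidth α β k ∧
      |((z - c) * (exp (-(Real.pi / 4 : ℝ) * I) * sideFrame k)).im| + η' ≤ sideHalfLength α β k := by
  set e' := exp (-(Real.pi / 4 : ℝ) * I) * sideFrame k with he'
  have hpe : (p - c) * e' = dParam α β k s * sideFrame k := by rw [he', ← mul_assoc]; exact congrArg (· * _) hP
  have hqe : (q - c) * e' = dParam α β k t * sideFrame k := by rw [he', ← mul_assoc]; exact congrArg (· * _) hQ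
  rw [segment_eq_image' ℝ p q] at hz
  obtain ⟨θ, ⟨hθ0, hθ1⟩, rfl⟩ := hz
  obtain ⟨hre, him⟩ := tilt_param c e' p q θ
  rw [hpe, hqe, re_dParam_mul_sideFrame, re_dParam_mul_sideFrame, sub_self, mul_zero, add_zero] at hre
  rw [hpe, hqe, im_dParam_mul_sideFrame, im_dParam_mul_sideFrame] at him
  refine ⟨hre, ?_⟩
  obtain ⟨hdp, hdq⟩ := dist_param p q hθ0 hθ1
  have hnorm : ‖q - p‖ = t - s := (sub_eq_of_segData c hP hQ).2 hst.le
  rw [hdp, hnorm] at hzp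
  rw [hdq, hnorm] at hzq
  have hL := two_mul_sideHalfLength α β k
  rw [him]
  have habs : |-sideHalfLength α β k + s + θ * (-sideHalfLength α β k + t - (-sideHalfLength α β k + s))| ≤
      sideHalfLength α β k - η' := by
    rw [abs_le]; constructor <;> nlinarith
  linarith

/-- **The bulk of a boundary segment of a marked diamond, eventually in the mesh** (registered helper of
`stub_exactPotentialTracePh2`). For a Dobrushin domain whose carrier is the open tilted rectangle (frame `dRot c`,
half-widths `α, β > 0`), an admissible family `Λ`, an oriented boundary segment `[p, q]` and a trim `η > 0`: the side
data `k, s, t` of the segment, and for all small `δ`: `δ > 0`, every lattice point of the diamond in `Ω_δ`, the layer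
formula of side `k` (orientation `k + 2`) with its last inside layer `n`, and for every lattice site within `6δ` of
`[p, q]` at distance `≥ η` from `p` and `q` the two bulk inequalities (`|im| + 3δ < sideHalfLength`,
`−sideHalfWidth + 3δ < re` in the frame `exp(-iπ/4)·sideFrame k`) under which `…DiamondTraceLayers.lean` reads the
carrier, the discrete boundary and the inner faces off `layerFn (k + 2)`. -/
theorem eventually_sideBulk : ∀ (D : DobrushinDomain) (c : ℂ) (α β : ℝ), 0 < α → 0 < β → D.carrier = {z | |((z - c) * exp (-(Real.pi / 4 : ℝ) * I)).re| < α ∧ |((z - c) * exp (-(Real.pi / 4 : ℝ) * I)).im| < β} → ∀ (Λ : ℝ → DiscreteDobrushin), IsFamily D Λ → ∀ (p q : ℂ), IsBdrySegment D p q → ∀ η : ℝ, 0 < η → ∃ (k : Fin 4) (s t : ℝ), 0 ≤ s ∧ s < t ∧ t ≤ dLen α β k ∧ dRot c p = dParam α β k s ∧ dRot c q = dParam α β k t ∧ ∀ᶠ δ in 𝓝[>] (0:ℝ), 0 < δ ∧ (∀ x : Site 2, meshPoint δ x ∈ (Λ δ).Ω → x ∈ meshDomain (Λ δ).Ω δ)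 ∧ ∃ (X₀ : ℝ) (n : ℤ), (∀ x : Site 2, ((meshPoint δ x - c) * (exp (-(Real.pi / 4 : ℝ) * I) * sideFrame k)).re = Real.sqrt 2 / 2 * δ * layerFn (k + 2) x + X₀) ∧ Real.sqrt 2 / 2 * δ * n + X₀ < sideHalfWidth α β k ∧ sideHalfWidth α β k ≤ Real.sqrt 2 / 2 * δ * (n + 1) + X₀ ∧ ∀ x : Site 2, infDist (meshPoint δ x) (segment ℝ p q) ≤ 6 * δ → η ≤ dist (meshPoint δ x) p → η ≤ dist (meshPoint δ x) q → |((meshPoint δ x - c) * (exp (-(Real.pi / 4 : ℝ) * I) * sideFrame k)).im| + 3 * δ < sideHalfLength α β k ∧ -sideHalfWidth α β k + 3 * δ < ((meshPoint δ x - c) * (exp (-(Real.pi / 4 : ℝ) * I) * sideFrame k)).re := by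
  intro D c α β hα hβ hcar Λ hΛ p q hpq η hη
  obtain ⟨k, s, t, hs, hst, ht, hP, hQ⟩ := segData_of_isBdrySegment hα hβ hcar hpq
  refine ⟨k, s, t, hs, hst, ht, hP, hQ, ?_⟩
  have hgoodev := eventually_mem_meshDomain_of_isMarkedDiamond D ⟨c, α, β, hα, hβ, hcar⟩
  have hm : 0 < min (η / 15) (min α β / 9) := lt_min (by positivity) (by positivity)
  filter_upwards [hgoodev, Ioo_mem_nhdsGT hm] with δ hgood hδ
  obtain ⟨hδ0, hδ1⟩ := hδ
  have hδη : 15 * δ < η := by have := lt_of_lt_of_le hδ1 (min_le_left _ _); linarith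
  have hδw : 9 * δ < sideHalfWidth α β k := by
    have := lt_of_lt_of_le hδ1 (min_le_right _ _)
    linarith [min_le_sideHalfWidth α β k]
  have hΩ : (Λ δ).Ω = D.carrier := hΛ.1 δ
  refine ⟨hδ0, by rw [hΩ]; exact hgood, ?_⟩
  obtain ⟨X₀, hX⟩ := exists_re_tilt_sideFrame_eq_layerFn δ c k
  obtain ⟨n, hn, hn'⟩ := exists_lastLayer (X₀ := X₀) (a := sideHalfWidth α β k)
    (show 0 < Real.sqrt 2 / 2 * δ by positivity)
  refine ⟨X₀, n, hX, hn, hn', fun x hx hxp hxq => ?_⟩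
  set e' := exp (-(Real.pi / 4 : ℝ) * I) * sideFrame k with he'
  have he1 : ‖e'‖ = 1 := by rw [he', norm_mul, norm_exp_neg_pi_div_four_mul_I, norm_sideFrame, mul_one]
  -- the nearest point of the segment
  have hcpt : IsCompact (segment ℝ p q) := by
    rw [segment_eq_image_lineMap]; exact isCompact_Icc.image AffineMap.lineMap_continuous
  obtain ⟨z, hz, hzd⟩ := hcpt.exists_infDist_eq_dist ⟨p, left_mem_segment ℝ p q⟩ (meshPoint δ x)
  have hxz : dist (meshPoint δ x) z ≤ 6 * δ := hzd ▸ hx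
  have hzp : η - 6 * δ ≤ dist z p := by linarith [dist_triangle (meshPoint δ x) z p]
  have hzq : η - 6 * δ ≤ dist z q := by linarith [dist_triangle (meshPoint δ x) z q]
  obtain ⟨hzre, hzim⟩ := tilt_of_mem_segment c hs hst ht hP hQ hz hzp hzq
  rw [dist_eq_norm] at hxz
  have hre := abs_le.1 ((abs_re_tilt_sub_le c e' he1 (meshPoint δ x) z).trans hxz)
  have him := abs_le.1 ((abs_im_tilt_sub_le c e' he1 (meshPoint δ x) z).trans hxz)
  have hzim' := abs_le.1 (show |((z - c) * e').im| ≤ sideHalfLength α β k - (η - 6 * δ) by linarith)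
  constructor
  · have : |((meshPoint δ x - c) * e').im| ≤ sideHalfLength α β k - η + 12 * δ := by
      rw [abs_le]; constructor <;> linarith
    linarith
  · linarith

end Summit.CriticalPhenomena.CardyFormulaZ2.Cruxes.ParafermionToSLESixFamilies.PotentialDarbouxPicardDiamond

end
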